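import Literature.AlgebraicGeometry.ShimuraVarieties.UnitaryCurveConjugateSliceEqOfForwardTwistedRecip   -- ★ p849947 (mine): the conjugate complex slice IS the second slice (forward law); re-exports ★ E5
import HarnessLib

/-!
# The conjugate-slice identity DESCENDS to the slice field: `(1 × Spec γ) ≫ ε ≫ pr₁ = ε₂ ≫ pr₁` on `M_K ⊗_L E`
# ([Milne 2005] Thm. 13.6 with two slices, read over the slice field by faithfully flat descent along `Spec ℂ → Spec E`; [GortzWedhorn2020] Prop. 4.16, (14.20))

Topic `AlgebraicGeometry/ShimuraVarieties`, namespace `…ShimuraVarieties.UnitaryCanonicalModel` (the objects of ★ `UnitaryShimuraCurveRecord` ∕ ★ E5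
`UnitaryCurveSiegelDescent`).  THEOREMS ONLY (no definition, no instance, no notation, no named fact, no `sorry`).  Cell `hodgecm-mathlib` (D-0151),
P6 «MOD programme», crux hLiu418 (stmt-HodgeConjecture-24832, `--supports`, count-neutral), line «L4», closer `Lines/F0_P6a_StubESHEET.lean` socket
`stub_SHEET` (LA4-plan (g2) DEAL #29: LA7-p01 (g3) lead, LA4-p03 (g2) the (S3)(S3♯) + (S3→S4) legs, LA4-p01 (g2) (S4)(S5)).  **THE (S3→S4) LEG
«COMPLEXIFY – CONJUGATE – DESCEND»**: E5 (★ `RecordSystemGS.exists_sliceDescent_of_complex`) produced the slice `ε : M_K ⊗_L E → M ⊗_ℚ E` from a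
complex slice `ψ` by Galois descent; here, conversely, TWO `E`-slices `ε, ε₂` whose complex points read `f, f₂ : Sh_K(ℂ) → M(ℂ)` are COMPLEXIFIED along
`τE` (transitivity isomorphisms ★ `Motives.exists_iso_baseChangeHom_baseChange`, points ★ `Motives.exists_homeomorph_complexPoints_baseChange`), the
(S3) head ★ `RecordSystemGS.gal_comp_sliceComplex_comp_gal_eq_sliceTwo_of_forward_recip` identifies the `σL`-conjugate of `ψ = ε_ℂ` with `ψ₂ = (ε₂)_ℂ`
for a lift `σL ∈ Aut_L(ℂ)` of `γ ∈ Aut_L(E)` (`σL ∘ τE = τE ∘ γ`) under the FORWARD twisted law at `σL`, and the identity is pushed down along the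
faithfully flat `pr : (M_K ⊗_L E)_ℂ → M_K ⊗_L E` (an epimorphism): the Galois automorphism `gal σL⁻¹ = 1 × Spec σL` of `(M_K)_ℂ` covers
`gal γ⁻¹ = 1 × Spec γ` of `M_K ⊗_L E` ([GortzWedhorn2020] (14.20)).  RESULT **`RecordSystemGS.gal_comp_slice_fst_eq_sliceTwo_fst`**:
`GaloisDescent.gal E (M_K) γ⁻¹ ≫ ε.left ≫ pr₁ = ε₂.left ≫ pr₁ : (M_K ⊗_L E) → M` — the two CLASSIFYING MAPS to the `ℚ`-scheme `M` agree up to the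
`γ`-twist of the slice base, which is what (S4) (fine moduli: equal classifying maps ⇒ isomorphic tuples, ★ `SerreCoverTransportAlongIso`) consumes with
`ε :=` the chart slice and `ε₂ :=` the classifying slice of the Serre-tensored tuple `P_𝔞` ((S1) ★ `SerreTwistModuliTuple`, reading (S2b) ★ p849685).
HONEST LABEL: HC_CM is proved only modulo the 2 remaining named inputs (hLiu418 24832, h413 24833) until rung 0 closes; this file is generic and count-neutral.

* §1 **`RecordSystemGS.lift_comp_sliceComplexOfSlice_fst`** — the complexified slice `u ≫ ε_ℂ ≫ tM` reads `f` on the points `(Q, 1)` (E5's point formula, reversed);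
* §2 **`RecordSystemGS.gal_comp_slice_fst_eq_sliceTwo_fst`** — THE LEG.

## References
* [Milne2005ShimuraVarieties] J. S. Milne, *Introduction to Shimura varieties* (2005; rev. 2017), §13: Prop. 13.1 p. 117, Lemma 13.5 and Thm. 13.6 p. 118; Def. 12.8 (62) p. 114.
* [GortzWedhorn2020] U. Görtz, T. Wedhorn, *Algebraic Geometry I* (2nd ed. 2020), Prop. 4.16, §(4.7), §(14.20), Thm. 14.72 (1).
* [Shimura1998] G. Shimura, *Abelian Varieties with Complex Multiplication and Modular Functions* (1998), §18.6 (pp. 124–128).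
* [RapoportSmithlingZhang2020Diagonal] M. Rapoport, B. Smithling, W. Zhang (2020), §3.2 p. 11 (the sheets of `M ⊗_F Fᵢ`).
-/

set_option autoImplicit false

noncomputable section

open Function MulAction Topology NumberField IsDedekindDomain CategoryTheory CategoryTheory.Limits Matrix
  AlgebraicGeometry Cardinal
open scoped Matrix ComplexOrder
open Literature.AlgebraicGeometry.Motives Literature.NumberTheory.Automorphic Literature.NumberTheory.Automorphic.UnitaryGroup
open Literature.NumberTheory.Automorphic.Liu2021.AppendixC (C5.OpenCompactSubgroup C5.SmallLevel)
open Literature.AlgebraicGeometry.Motives.AbelianVariety (bcSpec bcFunctor specAut)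

namespace Literature.AlgebraicGeometry.ShimuraVarieties.UnitaryCanonicalModel

variable {L : Type} [Field L] [NumberField L] [IsCMField L] {Jstar : Matrix (Fin 2) (Fin 2) L} {τ : L →+* ℂ}
  {K₀ : C5.OpenCompactSubgroup ↥(finAdelic (↥(maximalRealSubfield L)) L (IsCMField.complexConj L) 2 Jstar)}

section SliceTwist

variable (S : RecordSystemGS L Jstar τ K₀) (K : C5.SmallLevel K₀) (M : SchemeOver ℚ)
  {E : Type} [Field E] [NumberField E] [Algebra L E] (τE : E →+* ℂ) (hτ : τE.comp (algebraMap L E) = τ)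

/-! ### §1 Complexifying a slice: the point reading survives (E5's point formula run backwards) -/

set_option maxHeartbeats 800000 in -- large adelic ∕ Shimura-set terms: instance-heavy statements (as ★ `UnitaryCurveSiegelDescent` §4)
/-- **The complexified slice reads `f`.**  For an `E`-slice `ε : M_K ⊗_L E → M ⊗_ℚ E` «inducing `f`» on complex points (E5 currency: `ε(P) ≫ pr₁ = f (pts P♭)`
whenever `P♭ = P ≫ pr₁`), the underlying morphism `tε` of `ε_ℂ = ε ⊗_{E,τE} ℂ`, and morphisms `u : (M_K)_ℂ → (M_K ⊗_L E)_ℂ`, `tM : (M ⊗_ℚ E)_ℂ → M_ℂ` pinned by their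
projections (the transitivity isomorphisms of ★ `Motives.exists_iso_baseChangeHom_baseChange`), the complex slice `t := u ≫ tε ≫ tM : (M_K)_ℂ → M_ℂ` reads `f` on the
points `(Q, 1)`: `(Q, 1) ≫ t ≫ pr₁ = f (pts Q)` — the point `P := (Q,1) ≫ u ≫ pr₁` of `M_K ⊗_L E` lies over `Q`. [cite: GortzWedhorn2020, Prop. 4.16 and §(4.7)]
[cite: Milne2005ShimuraVarieties, Prop. 13.1 p. 117] -/
theorem RecordSystemGS.lift_comp_sliceComplexOfSlice_fst (f : ShimuraSetGS L Jstar τ K.1.1 → ComplexPoints M)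
    (ε : (Motives.baseChange L E).obj (S.M.obj K) ⟶ (Motives.baseChange ℚ E).obj M)
    (hε : letI : Algebra E ℂ := τE.toAlgebra
      ∀ (P : ComplexPoints ((Motives.baseChange L E).obj (S.M.obj K)))
        (Pflat : letI : Algebra L ℂ := τ.toAlgebra; ComplexPoints (S.M.obj K)),
        Pflat.left = P.left ≫ pullback.fst (S.M.obj K).hom (bcSpec L E) →
        (AlgPoints.map ε P).left ≫ pullback.fst M.hom (bcSpec ℚ E) =
          (letI : Algebra L ℂ := τ.toAlgebra; (f (S.pts K Pflat)).left))
    (tε : letI : Algebra E ℂ := τE.toAlgebra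
      GaloisDescent.bc ℂ ((Motives.baseChange L E).obj (S.M.obj K)) ⟶ GaloisDescent.bc ℂ ((Motives.baseChange ℚ E).obj M))
    (htε : letI : Algebra E ℂ := τE.toAlgebra; tε = ((bcFunctor E ℂ).map ε).left)
    (u : letI : Algebra E ℂ := τE.toAlgebra; letI : Algebra L ℂ := τ.toAlgebra
      GaloisDescent.bc ℂ (S.M.obj K) ⟶ GaloisDescent.bc ℂ ((Motives.baseChange L E).obj (S.M.obj K)))
    (hu1 : letI : Algebra E ℂ := τE.toAlgebra; letI : Algebra L ℂ := τ.toAlgebra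
      u ≫ pullback.fst ((Motives.baseChange L E).obj (S.M.obj K)).hom (bcSpec E ℂ) ≫ pullback.fst (S.M.obj K).hom (bcSpec L E) =
        pullback.fst (S.M.obj K).hom (bcSpec L ℂ))
    (hu2 : letI : Algebra E ℂ := τE.toAlgebra; letI : Algebra L ℂ := τ.toAlgebra
      u ≫ pullback.snd ((Motives.baseChange L E).obj (S.M.obj K)).hom (bcSpec E ℂ) = pullback.snd (S.M.obj K).hom (bcSpec L ℂ))
    (tM : letI : Algebra E ℂ := τE.toAlgebra; GaloisDescent.bc ℂ ((Motives.baseChange ℚ E).obj M) ⟶ GaloisDescent.bc ℂ M)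
    (htM1 : letI : Algebra E ℂ := τE.toAlgebra
      tM ≫ pullback.fst M.hom (bcSpec ℚ ℂ) = pullback.fst ((Motives.baseChange ℚ E).obj M).hom (bcSpec E ℂ) ≫ pullback.fst M.hom (bcSpec ℚ E))
    (Q : letI : Algebra L ℂ := τ.toAlgebra; ComplexPoints (S.M.obj K)) :
    letI : Algebra E ℂ := τE.toAlgebra; letI : Algebra L ℂ := τ.toAlgebra
    pullback.lift Q.toSpecHom (𝟙 (Spec (.of ℂ))) (toSpecHom_comp_hom_eq (τ := τ) (S.M.obj K) Q) ≫ (u ≫ tε ≫ tM) ≫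
        pullback.fst M.hom (bcSpec ℚ ℂ) =
      (f (S.pts K Q)).left := by
  letI iE : Algebra E ℂ := τE.toAlgebra; letI iL : Algebra L ℂ := τ.toAlgebra
  -- abstract the projections of `(M_K ⊗_L E)_ℂ` and `(M ⊗_ℚ E)_ℂ` and the underlying morphism of `ε` (clean types, as in ★ E5)
  obtain ⟨pX, hpX⟩ : ∃ pX : GaloisDescent.bc ℂ ((Motives.baseChange L E).obj (S.M.obj K)) ⟶ GaloisDescent.bc E (S.M.obj K),
      pX = pullback.fst ((Motives.baseChange L E).obj (S.M.obj K)).hom (bcSpec E ℂ) := ⟨_, rfl⟩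
  obtain ⟨qX, hqX⟩ : ∃ qX : GaloisDescent.bc ℂ ((Motives.baseChange L E).obj (S.M.obj K)) ⟶ Spec (.of ℂ),
      qX = pullback.snd ((Motives.baseChange L E).obj (S.M.obj K)).hom (bcSpec E ℂ) := ⟨_, rfl⟩
  obtain ⟨pY, hpY⟩ : ∃ pY : GaloisDescent.bc ℂ ((Motives.baseChange ℚ E).obj M) ⟶ GaloisDescent.bc E M,
      pY = pullback.fst ((Motives.baseChange ℚ E).obj M).hom (bcSpec E ℂ) := ⟨_, rfl⟩
  obtain ⟨εl, hεl⟩ : ∃ εl : GaloisDescent.bc E (S.M.obj K) ⟶ GaloisDescent.bc E M, εl = ε.left := ⟨_, rfl⟩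
  rw [← hpX] at hu1
  rw [← hqX] at hu2
  rw [← hpY] at htM1
  -- `ε_ℂ ≫ pr₁ = pr₁ ≫ ε`
  have hfl : ((bcFunctor E ℂ).map ε).left =
      pullback.lift (pullback.fst ((Motives.baseChange L E).obj (S.M.obj K)).hom (bcSpec E ℂ) ≫ ε.left)
        (pullback.snd ((Motives.baseChange L E).obj (S.M.obj K)).hom (bcSpec E ℂ))
        (by rw [Category.assoc, Over.w ε]; exact pullback.condition) :=
    Over.pullback_map_left _ _
  have hεfst : tε ≫ pY = pX ≫ εl := by
    rw [htε, hfl, hpY, hpX, hεl]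
    exact pullback.lift_fst _ _ _
  -- the point `P := (Q, 1) ≫ u ≫ pr₁` of `M_K ⊗_L E`, over `Q`
  have hcondX : pX ≫ ((Motives.baseChange L E).obj (S.M.obj K)).hom = qX ≫ bcSpec E ℂ := by
    rw [hpX, hqX]
    exact pullback.condition
  have hsnd : pullback.lift Q.toSpecHom (𝟙 (Spec (.of ℂ))) (toSpecHom_comp_hom_eq (τ := τ) (S.M.obj K) Q) ≫ u ≫ qX = 𝟙 _ := by
    rw [hu2, pullback.lift_snd]
  have hPhom : (pullback.lift Q.toSpecHom (𝟙 (Spec (.of ℂ))) (toSpecHom_comp_hom_eq (τ := τ) (S.M.obj K) Q) ≫ u ≫ pX) ≫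
      ((Motives.baseChange L E).obj (S.M.obj K)).hom = bcSpec E ℂ := by
    rw [Category.assoc, Category.assoc, hcondX, ← Category.assoc u, ← Category.assoc, hsnd, Category.id_comp]
  let P : ComplexPoints ((Motives.baseChange L E).obj (S.M.obj K)) :=
    Over.homMk (pullback.lift Q.toSpecHom (𝟙 (Spec (.of ℂ))) (toSpecHom_comp_hom_eq (τ := τ) (S.M.obj K) Q) ≫ u ≫ pX) hPhom
  have hPleft : P.left = pullback.lift Q.toSpecHom (𝟙 (Spec (.of ℂ))) (toSpecHom_comp_hom_eq (τ := τ) (S.M.obj K) Q) ≫ u ≫ pX := rfl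
  have hPQ : Q.left = P.left ≫ pullback.fst (S.M.obj K).hom (bcSpec L E) := by
    show Q.left = (pullback.lift Q.toSpecHom (𝟙 (Spec (.of ℂ))) (toSpecHom_comp_hom_eq (τ := τ) (S.M.obj K) Q) ≫ u ≫ pX) ≫
      pullback.fst (S.M.obj K).hom (bcSpec L E)
    erw [Category.assoc, Category.assoc, hu1, pullback.lift_fst]
  -- assemble: `(Q,1) ≫ u ≫ tε ≫ tM ≫ pr₁ = (Q,1) ≫ u ≫ tε ≫ pr₁ ≫ pr₁ = ((Q,1) ≫ u ≫ pr₁) ≫ ε ≫ pr₁ = P ≫ ε ≫ pr₁ = f (pts Q)`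
  have h : pullback.lift Q.toSpecHom (𝟙 (Spec (.of ℂ))) (toSpecHom_comp_hom_eq (τ := τ) (S.M.obj K) Q) ≫ u ≫ pX ≫ εl ≫
      pullback.fst M.hom (bcSpec ℚ E) = (f (S.pts K Q)).left := by
    have h0 := hε P Q hPQ
    erw [AlgPoints.map_apply, Over.comp_left, Category.assoc, Category.assoc, Category.assoc] at h0
    rw [hεl]
    exact h0
  rw [Category.assoc, Category.assoc, htM1]
  erw [reassoc_of% hεfst]
  exact h

/-! ### §2 THE LEG: complexify – conjugate – descend -/

set_option maxHeartbeats 800000 in -- instance-heavy slice readings + the (S3) head + descent bookkeeping (as ★ `UnitaryCurveSiegelDescent` §4)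
include hτ in
/-- **THE CONJUGATE-SLICE IDENTITY DESCENDS TO THE SLICE FIELD.**  For the curve record system `S` over `L` along `τ`, `J⋆` hermitian with unit determinant, a
small level `K`, a `ℚ`-scheme `M` separated over `ℚ`, a number field `E ⊇ L` with `τE ∘ (L → E) = τ`, TWO `E`-slices `ε, ε₂ : M_K ⊗_L E → M ⊗_ℚ E` reading
`f, f₂ : Sh_K(ℂ) → M(ℂ)` on complex points (E5 currency), `γ ∈ Aut_L(E)` with a lift `σL ∈ Aut_L(ℂ)` (`σL ∘ τE = τE ∘ γ`), and the FORWARD twisted law at `σL`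
(`s ↔ σL`, twist `d` at the special `x₀ = [τw]`, `σL|_ℚ • f[x₀, a] = f₂[x₀, d·a]` for all `a`):
**`(1 × Spec γ) ≫ ε ≫ pr₁ = ε₂ ≫ pr₁ : M_K ⊗_L E → M`** (`GaloisDescent.gal E (M_K) γ⁻¹ = 1 × Spec γ`).  PROOF: complexify both slices along `τE`
(§1 + ★ `Motives.exists_iso_baseChangeHom_baseChange`) into `ψ, ψ₂ : (M_K)_ℂ → M_ℂ` reading `f, f₂`; ★ `gal_comp_sliceComplex_comp_gal_eq_sliceTwo_of_forward_recip`
gives `gal σL⁻¹ ≫ ψ ≫ gal σL|_ℚ = ψ₂`; the automorphism `gX ≫ gal σL⁻¹ ≫ gX⁻¹` of `(M_K ⊗_L E)_ℂ` covers `gal γ⁻¹` ([GortzWedhorn2020] (14.20): `σL` lifts `γ`);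
composing with the projections and cancelling the epimorphism `pr : (M_K ⊗_L E)_ℂ → M_K ⊗_L E` (flat, surjective) gives the identity over `E`.
[cite: Milne2005ShimuraVarieties, Thm. 13.6 p. 118 and Prop. 13.1 p. 117] [cite: GortzWedhorn2020, Prop. 4.16, §(14.20), Thm. 14.72 (1)]
[cite: Shimura1998, §18.6 (pp. 124–128)] [cite: RapoportSmithlingZhang2020Diagonal, §3.2 p. 11] -/
theorem RecordSystemGS.gal_comp_slice_fst_eq_sliceTwo_fst [IsSeparated M.hom]
    (hJ : (Jstar.map (IsCMField.complexConj L))ᵀ = Jstar) (hdet : IsUnit Jstar.det)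
    (f f₂ : ShimuraSetGS L Jstar τ K.1.1 → ComplexPoints M)
    (ε ε₂ : (Motives.baseChange L E).obj (S.M.obj K) ⟶ (Motives.baseChange ℚ E).obj M)
    (hε : letI : Algebra E ℂ := τE.toAlgebra
      ∀ (P : ComplexPoints ((Motives.baseChange L E).obj (S.M.obj K)))
        (Pflat : letI : Algebra L ℂ := τ.toAlgebra; ComplexPoints (S.M.obj K)),
        Pflat.left = P.left ≫ pullback.fst (S.M.obj K).hom (bcSpec L E) →
        (AlgPoints.map ε P).left ≫ pullback.fst M.hom (bcSpec ℚ E) =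
          (letI : Algebra L ℂ := τ.toAlgebra; (f (S.pts K Pflat)).left))
    (hε₂ : letI : Algebra E ℂ := τE.toAlgebra
      ∀ (P : ComplexPoints ((Motives.baseChange L E).obj (S.M.obj K)))
        (Pflat : letI : Algebra L ℂ := τ.toAlgebra; ComplexPoints (S.M.obj K)),
        Pflat.left = P.left ≫ pullback.fst (S.M.obj K).hom (bcSpec L E) →
        (AlgPoints.map ε₂ P).left ≫ pullback.fst M.hom (bcSpec ℚ E) =
          (letI : Algebra L ℂ := τ.toAlgebra; (f₂ (S.pts K Pflat)).left))
    (γ : E ≃ₐ[L] E) (σL : letI : Algebra L ℂ := τ.toAlgebra; ℂ ≃ₐ[L] ℂ) (hσγ : ∀ x : E, σL (τE x) = τE (γ x))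
    {w : Fin 2 → L} (hw : (fun i => τ (w i)) ∈ negCone (Jstar.map τ)) {s : (FiniteAdeleRing (𝓞 L) L)ˣ}
    (hs : letI : Algebra L ℂ := τ.toAlgebra; IsArtinCorrespondent L τ s σL.toRingEquiv)
    {d : ↥(finAdelic (↥(maximalRealSubfield L)) L (IsCMField.complexConj L) 2 Jstar)}
    (hd : IsDiagTwistGS L Jstar w (recipFactor L s) d)
    (hfw : letI : Algebra L ℂ := τ.toAlgebra
      ∀ a : ↥(finAdelic (↥(maximalRealSubfield L)) L (IsCMField.complexConj L) 2 Jstar),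
        (σL.restrictScalars ℚ) • f (ShimuraSetGS.mk L Jstar τ K.1.1 (fun i => τ (w i)) hw a) =
          f₂ (ShimuraSetGS.mk L Jstar τ K.1.1 (fun i => τ (w i)) hw (d * a))) :
    GaloisDescent.gal E (S.M.obj K) γ⁻¹ ≫ ε.left ≫ pullback.fst M.hom (bcSpec ℚ E) = ε₂.left ≫ pullback.fst M.hom (bcSpec ℚ E) := by
  letI iE : Algebra E ℂ := τE.toAlgebra; letI iL : Algebra L ℂ := τ.toAlgebra
  -- the transitivity isomorphisms `gX : (M_K ⊗_L E)_ℂ ≅ (M_K)_ℂ`, `gM : (M ⊗_ℚ E)_ℂ ≅ M_ℂ`, read on underlying morphisms (E5 bookkeeping)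
  obtain ⟨gX, hgX1, hgX2, -⟩ := Motives.exists_iso_baseChangeHom_baseChange hτ (S.M.obj K)
  have hτℚ : τE.comp (algebraMap ℚ E) = algebraMap ℚ ℂ := Subsingleton.elim _ _
  obtain ⟨gM, hgM1, -, -⟩ := Motives.exists_iso_baseChangeHom_baseChange (τ := algebraMap ℚ ℂ) hτℚ M
  obtain ⟨tX, htX⟩ : ∃ tX : GaloisDescent.bc ℂ ((Motives.baseChange L E).obj (S.M.obj K)) ⟶ GaloisDescent.bc ℂ (S.M.obj K),
      tX = gX.hom.left := ⟨_, rfl⟩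
  obtain ⟨u, hu⟩ : ∃ u : GaloisDescent.bc ℂ (S.M.obj K) ⟶ GaloisDescent.bc ℂ ((Motives.baseChange L E).obj (S.M.obj K)),
      u = gX.inv.left := ⟨_, rfl⟩
  obtain ⟨tM, htM⟩ : ∃ tM : GaloisDescent.bc ℂ ((Motives.baseChange ℚ E).obj M) ⟶ GaloisDescent.bc ℂ M, tM = gM.hom.left := ⟨_, rfl⟩
  obtain ⟨tε, htε⟩ : ∃ tε : GaloisDescent.bc ℂ ((Motives.baseChange L E).obj (S.M.obj K)) ⟶ GaloisDescent.bc ℂ ((Motives.baseChange ℚ E).obj M),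
      tε = ((bcFunctor E ℂ).map ε).left := ⟨_, rfl⟩
  obtain ⟨tε₂, htε₂⟩ : ∃ tε₂ : GaloisDescent.bc ℂ ((Motives.baseChange L E).obj (S.M.obj K)) ⟶ GaloisDescent.bc ℂ ((Motives.baseChange ℚ E).obj M),
      tε₂ = ((bcFunctor E ℂ).map ε₂).left := ⟨_, rfl⟩
  have hXu : tX ≫ u = 𝟙 _ := by rw [htX, hu]; exact congrArg CommaMorphism.left gX.hom_inv_id
  have huX : u ≫ tX = 𝟙 _ := by rw [htX, hu]; exact congrArg CommaMorphism.left gX.inv_hom_id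
  have hgX1' : tX ≫ pullback.fst (S.M.obj K).hom (bcSpec L ℂ) =
      pullback.fst ((Motives.baseChange L E).obj (S.M.obj K)).hom (bcSpec E ℂ) ≫ pullback.fst (S.M.obj K).hom (bcSpec L E) := by
    rw [htX]; exact hgX1
  have hgX2' : tX ≫ pullback.snd (S.M.obj K).hom (bcSpec L ℂ) = pullback.snd ((Motives.baseChange L E).obj (S.M.obj K)).hom (bcSpec E ℂ) := by
    rw [htX]; exact hgX2
  have hgM1' : tM ≫ pullback.fst M.hom (bcSpec ℚ ℂ) =
      pullback.fst ((Motives.baseChange ℚ E).obj M).hom (bcSpec E ℂ) ≫ pullback.fst M.hom (bcSpec ℚ E) := by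
    rw [htM]; exact hgM1
  have hu1 : u ≫ pullback.fst ((Motives.baseChange L E).obj (S.M.obj K)).hom (bcSpec E ℂ) ≫ pullback.fst (S.M.obj K).hom (bcSpec L E) =
      pullback.fst (S.M.obj K).hom (bcSpec L ℂ) := by
    rw [← hgX1', ← Category.assoc, huX, Category.id_comp]
  have hu2 : u ≫ pullback.snd ((Motives.baseChange L E).obj (S.M.obj K)).hom (bcSpec E ℂ) = pullback.snd (S.M.obj K).hom (bcSpec L ℂ) := by
    rw [← hgX2', ← Category.assoc, huX, Category.id_comp]
  -- the complex slices `ψ := gX⁻¹ ≫ ε_ℂ ≫ gM`, `ψ₂ := gX⁻¹ ≫ (ε₂)_ℂ ≫ gM` and their readings (§1)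
  let ψ : (Motives.baseChangeHom τ).obj (S.M.obj K) ⟶ (Motives.baseChange ℚ ℂ).obj M := gX.inv ≫ (bcFunctor E ℂ).map ε ≫ gM.hom
  let ψ₂ : (Motives.baseChangeHom τ).obj (S.M.obj K) ⟶ (Motives.baseChange ℚ ℂ).obj M := gX.inv ≫ (bcFunctor E ℂ).map ε₂ ≫ gM.hom
  obtain ⟨t, ht⟩ : ∃ t : GaloisDescent.bc ℂ (S.M.obj K) ⟶ GaloisDescent.bc ℂ M, t = ψ.left := ⟨_, rfl⟩
  obtain ⟨t₂, ht₂⟩ : ∃ t₂ : GaloisDescent.bc ℂ (S.M.obj K) ⟶ GaloisDescent.bc ℂ M, t₂ = ψ₂.left := ⟨_, rfl⟩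
  have htdef : t = u ≫ tε ≫ tM := by rw [ht, hu, htε, htM]; rfl
  have htdef₂ : t₂ = u ≫ tε₂ ≫ tM := by rw [ht₂, hu, htε₂, htM]; rfl
  have hψ : ∀ P : ComplexPoints (S.M.obj K),
      (AlgPoints.map ψ (AlgPoints.baseChangeEquiv τ (S.M.obj K) P)).left ≫ Motives.baseChangeHomFst (algebraMap ℚ ℂ) M =
        (f (S.pts K P)).left := by
    intro P
    have h1 := S.lift_comp_sliceComplexOfSlice_fst K M τE f ε hε tε htε u hu1 hu2 tM hgM1' P
    rw [AlgPoints.map_apply, Over.comp_left, ← lift_eq_baseChangeEquiv_left, ← ht, htdef]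
    erw [Category.assoc]
    exact h1
  have hψ₂ : ∀ P : ComplexPoints (S.M.obj K),
      (AlgPoints.map ψ₂ (AlgPoints.baseChangeEquiv τ (S.M.obj K) P)).left ≫ Motives.baseChangeHomFst (algebraMap ℚ ℂ) M =
        (f₂ (S.pts K P)).left := by
    intro P
    have h1 := S.lift_comp_sliceComplexOfSlice_fst K M τE f₂ ε₂ hε₂ tε₂ htε₂ u hu1 hu2 tM hgM1' P
    rw [AlgPoints.map_apply, Over.comp_left, ← lift_eq_baseChangeEquiv_left, ← ht₂, htdef₂]
    erw [Category.assoc]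
    exact h1
  -- the (S3) head over ℂ: `gal σL⁻¹ ≫ ψ ≫ gal σL|ℚ = ψ₂`
  obtain ⟨e, he⟩ := S.exists_homeomorph_complexFibre K
  have hhead := S.gal_comp_sliceComplex_comp_gal_eq_sliceTwo_of_forward_recip K M f f₂ ψ ψ₂ hψ hψ₂ t ht t₂ ht₂ hJ hdet e he σL
    hw hs hd hfw
  have hh2 : GaloisDescent.gal ℂ (S.M.obj K) σL⁻¹ ≫ t = t₂ ≫ GaloisDescent.gal ℂ M (σL.restrictScalars ℚ)⁻¹ := by
    have h := congrArg (· ≫ GaloisDescent.gal ℂ M (σL.restrictScalars ℚ)⁻¹) hhead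
    simpa only [Category.assoc, GaloisDescent.gal_comp_gal_symm, Category.comp_id] using h
  -- abstract projections of `(M_K ⊗_L E)_ℂ`, `(M ⊗_ℚ E)_ℂ` and the underlying morphisms of `ε, ε₂`
  obtain ⟨pX, hpX⟩ : ∃ pX : GaloisDescent.bc ℂ ((Motives.baseChange L E).obj (S.M.obj K)) ⟶ GaloisDescent.bc E (S.M.obj K),
      pX = pullback.fst ((Motives.baseChange L E).obj (S.M.obj K)).hom (bcSpec E ℂ) := ⟨_, rfl⟩
  obtain ⟨qX, hqX⟩ : ∃ qX : GaloisDescent.bc ℂ ((Motives.baseChange L E).obj (S.M.obj K)) ⟶ Spec (.of ℂ),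
      qX = pullback.snd ((Motives.baseChange L E).obj (S.M.obj K)).hom (bcSpec E ℂ) := ⟨_, rfl⟩
  obtain ⟨pY, hpY⟩ : ∃ pY : GaloisDescent.bc ℂ ((Motives.baseChange ℚ E).obj M) ⟶ GaloisDescent.bc E M,
      pY = pullback.fst ((Motives.baseChange ℚ E).obj M).hom (bcSpec E ℂ) := ⟨_, rfl⟩
  obtain ⟨εl, hεl⟩ : ∃ εl : GaloisDescent.bc E (S.M.obj K) ⟶ GaloisDescent.bc E M, εl = ε.left := ⟨_, rfl⟩
  obtain ⟨εl₂, hεl₂⟩ : ∃ εl₂ : GaloisDescent.bc E (S.M.obj K) ⟶ GaloisDescent.bc E M, εl₂ = ε₂.left := ⟨_, rfl⟩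
  have hfl : ∀ ε' : (Motives.baseChange L E).obj (S.M.obj K) ⟶ (Motives.baseChange ℚ E).obj M, ((bcFunctor E ℂ).map ε').left =
      pullback.lift (pullback.fst ((Motives.baseChange L E).obj (S.M.obj K)).hom (bcSpec E ℂ) ≫ ε'.left)
        (pullback.snd ((Motives.baseChange L E).obj (S.M.obj K)).hom (bcSpec E ℂ))
        (by rw [Category.assoc, Over.w ε']; exact pullback.condition) :=
    fun ε' => Over.pullback_map_left _ _
  have hεfst : tε ≫ pY = pX ≫ εl := by
    rw [htε, hfl, hpY, hpX, hεl]
    exact pullback.lift_fst _ _ _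
  have hεfst₂ : tε₂ ≫ pY = pX ≫ εl₂ := by
    rw [htε₂, hfl, hpY, hpX, hεl₂]
    exact pullback.lift_fst _ _ _
  have hgX1'' : tX ≫ pullback.fst (S.M.obj K).hom (bcSpec L ℂ) = pX ≫ pullback.fst (S.M.obj K).hom (bcSpec L E) := by
    rw [hpX]; exact hgX1'
  have hgX2'' : tX ≫ pullback.snd (S.M.obj K).hom (bcSpec L ℂ) = qX := by rw [hqX]; exact hgX2'
  have hu1' : u ≫ pX ≫ pullback.fst (S.M.obj K).hom (bcSpec L E) = pullback.fst (S.M.obj K).hom (bcSpec L ℂ) := by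
    rw [hpX]; exact hu1
  have hu2' : u ≫ qX = pullback.snd (S.M.obj K).hom (bcSpec L ℂ) := by rw [hqX]; exact hu2
  have hgM1'' : tM ≫ pullback.fst M.hom (bcSpec ℚ ℂ) = pY ≫ pullback.fst M.hom (bcSpec ℚ E) := by rw [hpY]; exact hgM1'
  have hcondX : pX ≫ pullback.snd (S.M.obj K).hom (bcSpec L E) = qX ≫ bcSpec E ℂ := by
    rw [hpX, hqX]
    exact pullback.condition
  -- `σL` lifts `γ`: `Spec σL ≫ Spec τE = Spec τE ≫ Spec γ`
  have hSpec : specAut ℂ σL ≫ bcSpec E ℂ = bcSpec E ℂ ≫ specAut E γ := by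
    have hring : ((σL : ℂ ≃ₐ[L] ℂ) : ℂ →+* ℂ).comp (algebraMap E ℂ) = (algebraMap E ℂ).comp (γ : E →+* E) :=
      RingHom.ext fun x => hσγ x
    change Spec.map (CommRingCat.ofHom ((σL : ℂ ≃ₐ[L] ℂ) : ℂ →+* ℂ)) ≫ Spec.map (CommRingCat.ofHom (algebraMap E ℂ)) =
      Spec.map (CommRingCat.ofHom (algebraMap E ℂ)) ≫ Spec.map (CommRingCat.ofHom (γ : E →+* E))
    rw [← Spec.map_comp, ← Spec.map_comp, ← CommRingCat.ofHom_comp, ← CommRingCat.ofHom_comp, hring]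
  -- the automorphism `gX ≫ gal σL⁻¹ ≫ gX⁻¹` of `(M_K ⊗_L E)_ℂ` covers `gal γ⁻¹` of `M_K ⊗_L E`
  have hG : (tX ≫ GaloisDescent.gal ℂ (S.M.obj K) σL⁻¹ ≫ u) ≫ pX = pX ≫ GaloisDescent.gal E (S.M.obj K) γ⁻¹ := by
    apply pullback.hom_ext
    · rw [Category.assoc, Category.assoc, Category.assoc, Category.assoc, hu1', GaloisDescent.gal_fst, hgX1'',
        GaloisDescent.gal_fst]
    · rw [Category.assoc, Category.assoc, Category.assoc, Category.assoc, hcondX, reassoc_of% hu2', GaloisDescent.gal_snd_assoc,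
        reassoc_of% hgX2'', GaloisDescent.gal_snd, reassoc_of% hcondX, inv_inv, inv_inv, hSpec]
  -- `pr : (M_K ⊗_L E)_ℂ → M_K ⊗_L E` is an epimorphism (flat and surjective)
  haveI : Flat pX := by
    rw [hpX]
    exact MorphismProperty.pullback_fst _ _ inferInstance
  haveI : _root_.AlgebraicGeometry.Surjective pX := by
    rw [hpX]
    exact MorphismProperty.pullback_fst _ _ ⟨fun _ ↦ ⟨Classical.arbitrary _, Subsingleton.elim _ _⟩⟩
  haveI : Epi pX := Flat.epi_of_flat_of_surjective pX
  -- both sides pulled back to `(M_K ⊗_L E)_ℂ`, in terms of the complex slices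
  have eL : pX ≫ εl ≫ pullback.fst M.hom (bcSpec ℚ E) = tε ≫ tM ≫ pullback.fst M.hom (bcSpec ℚ ℂ) := by
    rw [hgM1'', ← reassoc_of% hεfst]
  have eL₂ : pX ≫ εl₂ ≫ pullback.fst M.hom (bcSpec ℚ E) = tε₂ ≫ tM ≫ pullback.fst M.hom (bcSpec ℚ ℂ) := by
    rw [hgM1'', ← reassoc_of% hεfst₂]
  have key : GaloisDescent.gal E (S.M.obj K) γ⁻¹ ≫ εl ≫ pullback.fst M.hom (bcSpec ℚ E) = εl₂ ≫ pullback.fst M.hom (bcSpec ℚ E) := by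
    rw [← cancel_epi pX, ← reassoc_of% hG, eL, eL₂, ← reassoc_of% htdef, reassoc_of% hh2, GaloisDescent.gal_fst, reassoc_of% htdef₂,
      reassoc_of% hXu]
  rw [hεl, hεl₂] at key
  exact key

end SliceTwist

end Literature.AlgebraicGeometry.ShimuraVarieties.UnitaryCanonicalModel

end
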